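import Literature.Analysis.ValidatedNumerics.TaylorModelSinCos
import Literature.Analysis.ValidatedNumerics.TaylorModelTrivariate
import HarnessLib

/-!
# Bivariate and trivariate Taylor models of `sin ∘ g` and `cos ∘ g` (trigonometric intrinsics in two and three variables)

Trunk T-ANA (Analysis/ValidatedNumerics); namespace `Literature.Analysis.ValidatedNumerics.PolyMP`.
Sequel of `TaylorModelSinCos.lean` (the univariate `tsinTM` / `tcosTM`: point values `(cos c, sin c)` from
`cisPt` WITHOUT argument reduction, small-argument compositions by Horner evaluation in `w = u²`, addition theorems),
`TaylorModelBivariate.lean` (`TMem2`, `tmul2`, `thorner2`, `tabs2`, `widen00`, `mid00`) and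
`TaylorModelTrivariate.lean` (`TMem3`, `tmul3`, `thorner3`, `tabs3`, `widen000`, `mid000`).  The same Joldeş `TMComp`
scheme (split off the rational midpoint `c` of the constant coefficient, expand the rest) in two and three variables:
for a Taylor model `G` of `g` on the box, `u = g − c`,

  `sin g = sin c · cos u + cos c · sin u`,   `cos g = cos c · cos u − sin c · sin u`,

* `tcosComp2 / tsinComp2` (`tmem2_cosComp`, `tmem2_sinComp`) and `tcosComp3 / tsinComp3` (`tmem3_cosComp`,
  `tmem3_sinComp`): Horner evaluations in `w = u²` of `Σ_{l<K} (−1)^l w^l/(2l)!` and `u · Σ_{l<K} (−1)^l w^l/(2l+1)!` in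
  bivariate / trivariate Taylor-model arithmetic, the common remainder `|u|^{2K} (2K+1)/((2K)!·2K)` (`|u| ≤ 1`,
  `NumericsMP.FB.cos_sin_taylor_remainder`) folded into the constant coefficient, the range bound certified by
  `|u|·S ≤ tabs2 ≤ S` (resp. `tabs3`);
* `tsin2TM / tcos2TM S h k D K Kt kt G` and `tsin3TM / tcos3TM S h k l D K Kt kt G` return the model with its ACCEPTANCE
  FLAG (`0 < K`, range bound, point value `cisPt S Kt kt (ofRat S c)` accepted): `tmem2_sin_of_tsin2TM`,
  `tmem2_cos_of_tcos2TM`, `tmem3_sin_of_tsin3TM`, `tmem3_cos_of_tcos3TM`.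

Problem-independent plumbing for kernel-checked double- and triple-integral certificates with trigonometric integrands
(the `sin` / `cos` nodes of the expression languages of `TaylorModelIntegralCert2DTrig.lean` and
`TaylorModelIntegralCert3DTrig.lean`); no facts, no axioms; all data computable over `ℤ`.

## References

* M. Joldeş, *Rigorous Polynomial Approximations and Applications*, PhD thesis, ENS Lyon (2011): Section 2.2.1
  (Taylor models of `sin`, `cos` by Taylor–Lagrange coefficients and remainder) and Algorithm 2.2.8 `TMComp`
  (composition with a basic function: split off the constant coefficient, model the basic function around it over the
  bound of the argument, compose by polynomial evaluation). [cite: Joldes2011, Algorithm 2.2.8]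
  [cite: Joldes2011, Section 2.2.1]
* K. Makino, M. Berz, *Taylor models and other validated functional inclusion methods*, Int. J. Pure Appl. Math. 4
  (2003) 379–456: Definition 3 (multivariate intrinsics by addition theorems, `sin`/`cos` eq. (2.10)–(2.11)).
  [cite: MakinoBerz2003, Definition 3]
* R. P. Brent, P. Zimmermann, *Modern Computer Arithmetic*, Cambridge Univ. Press (2010), §4.3.1 / §4.8.5 (doubling
  scheme for `exp`, `cos x + i sin x = exp(ix)`) — the point values `cisPt`. [cite: BrentZimmermann2010, §4.3.1]
* The series of `e^{iφ}` with remainder split into real and imaginary parts (`NumericsMP.FB.cos_sin_taylor_remainder`,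
  from Mathlib `Complex.exp_bound`). [folklore]
-/

namespace Literature.Analysis.ValidatedNumerics

namespace PolyMP

open Literature.Analysis.ValidatedNumerics.NumericsMP
open Literature.Analysis.ValidatedNumerics.ExpPoly (Poly)

/-! ### Shared series identities and the scaled remainder -/

/-- `P_cos(u²) = Σ_{l<K} (−1)^l u^{2l}/(2l)!`. [folklore] -/
private theorem eval_cosHalfCoeffs_sq_mv (K : ℕ) (u : ℝ) :
    Poly.eval (cosHalfCoeffs K) (u * u) = ∑ l ∈ Finset.range K, (-1 : ℝ) ^ l * u ^ (2 * l) / (2 * l).factorial := by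
  rw [cosHalfCoeffs, poly_eval_map_range]
  refine Finset.sum_congr rfl fun l _ => ?_
  rw [← sq, ← pow_mul]
  push_cast
  ring

/-- `u · P_sin(u²) = Σ_{l<K} (−1)^l u^{2l+1}/(2l+1)!`. [folklore] -/
private theorem mul_eval_sinHalfCoeffs_sq_mv (K : ℕ) (u : ℝ) :
    u * Poly.eval (sinHalfCoeffs K) (u * u) =
      ∑ l ∈ Finset.range K, (-1 : ℝ) ^ l * u ^ (2 * l + 1) / (2 * l + 1).factorial := by
  rw [sinHalfCoeffs, poly_eval_map_range, Finset.mul_sum]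
  refine Finset.sum_congr rfl fun l _ => ?_
  rw [← sq, ← pow_mul, pow_succ]
  push_cast
  ring

/-- The scaled remainder estimate `|r|·S ≤ ttrigCompRem S B K` from `|u| ≤ B/S` and the Taylor remainder. [folklore] -/
private theorem trig_rem_scaled_mv {S : ℕ} (hS : 0 < S) {B : ℤ} {K : ℕ} {u r : ℝ} (huB : |u| ≤ (B : ℝ) / S)
    (hr : |r| ≤ |u| ^ (2 * K) * ((2 * K + 1) / ((2 * K).factorial * (2 * K)))) :
    |r| * S ≤ (ttrigCompRem S B K : ℝ) := by
  have hSr : (0 : ℝ) < S := by exact_mod_cast hS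
  have h2 : |u| ^ (2 * K) ≤ ((B : ℝ) / S) ^ (2 * K) := pow_le_pow_left₀ (abs_nonneg _) huB _
  have hc : (0 : ℝ) ≤ (2 * K + 1 : ℝ) / (((2 * K).factorial : ℝ) * (2 * K)) := by positivity
  have h3 := hr.trans (mul_le_mul_of_nonneg_right h2 hc)
  have h4 : ((S : ℚ) * ((((B : ℚ) / S) ^ (2 * K)) * ((2 * K + 1 : ℚ) / (((2 * K).factorial : ℚ) * (2 * K)))) : ℝ) ≤
      (ttrigCompRem S B K : ℝ) := by
    unfold ttrigCompRem; exact_mod_cast Int.le_ceil _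
  refine le_trans ?_ h4
  push_cast
  rw [mul_comm ((S : ℕ) : ℝ)]
  exact mul_le_mul_of_nonneg_right h3 hSr.le

/-! ### Two variables: `cos ∘ u`, `sin ∘ u` for a small `u`, then `sin ∘ g`, `cos ∘ g` -/

/-- The bivariate Taylor model of `(ρ, σ) ↦ cos (u ρ σ)` for a small `u`: Horner on `cosHalfCoeffs K` at the model of
`u²`, plus the remainder folded into the constant coefficient. [cite: Joldes2011, Section 2.2.1]
[cite: MakinoBerz2003, Definition 3] -/
def tcosComp2 (S : ℕ) (h k : ℚ) (D K : ℕ) (U : IPoly2) : IPoly2 :=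
  widen00 (thorner2 S h k D (cosHalfCoeffs K) (tmul2 S h k D U U)) (ttrigCompRem S (tabs2 S h k U) K)

/-- The bivariate Taylor model of `(ρ, σ) ↦ sin (u ρ σ)` for a small `u`: `U ·` Horner on `sinHalfCoeffs K` at the
model of `u²`, plus the remainder. [cite: Joldes2011, Section 2.2.1] [cite: MakinoBerz2003, Definition 3] -/
def tsinComp2 (S : ℕ) (h k : ℚ) (D K : ℕ) (U : IPoly2) : IPoly2 :=
  widen00 (tmul2 S h k D U (thorner2 S h k D (sinHalfCoeffs K) (tmul2 S h k D U U)))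
    (ttrigCompRem S (tabs2 S h k U) K)

/-- **Soundness of `tcosComp2`** (`0 < K`, `tabs2 S h k U ≤ S`). [cite: Joldes2011, Section 2.2.1]
[cite: MakinoBerz2003, Definition 3] -/
theorem tmem2_cosComp {S : ℕ} (hS : 0 < S) {h k : ℚ} (h0 : 0 ≤ h) (k0 : 0 ≤ k) (D : ℕ) {K : ℕ} (hK : 0 < K)
    {u : ℝ → ℝ → ℝ} {U : IPoly2} (hu : TMem2 S h k u U) (hB : tabs2 S h k U ≤ S) :
    TMem2 S h k (fun ρ σ => Real.cos (u ρ σ)) (tcosComp2 S h k D K U) := by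
  intro ρ σ hρ hσ
  have hW : TMem2 S h k (fun ρ σ => u ρ σ * u ρ σ) (tmul2 S h k D U U) := tmem2_mul hS h0 k0 D hu hu
  obtain ⟨as, has, hev⟩ := tmem2_horner hS h0 k0 D hW (cosHalfCoeffs K) ρ σ hρ hσ
  have hSr : (0 : ℝ) < S := by exact_mod_cast hS
  have habs := abs_le_tabs2 h0 k0 hu hρ hσ
  have huB : |u ρ σ| ≤ ((tabs2 S h k U : ℤ) : ℝ) / S := by rw [le_div_iff₀ hSr]; exact habs
  have hu1 : |u ρ σ| ≤ 1 := by
    have : ((tabs2 S h k U : ℤ) : ℝ) ≤ S := by exact_mod_cast hB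
    exact huB.trans ((div_le_one hSr).2 this)
  have hrem := (FB.cos_sin_taylor_remainder hu1 hK).1
  rw [← eval_cosHalfCoeffs_sq_mv] at hrem
  have hδle := trig_rem_scaled_mv hS huB hrem
  obtain ⟨bs, hbs, hev2⟩ := exists_widen00 has hδle ρ σ
  refine ⟨bs, hbs, ?_⟩
  rw [hev2, ← hev]
  ring

/-- **Soundness of `tsinComp2`** (`0 < K`, `tabs2 S h k U ≤ S`). [cite: Joldes2011, Section 2.2.1]
[cite: MakinoBerz2003, Definition 3] -/
theorem tmem2_sinComp {S : ℕ} (hS : 0 < S) {h k : ℚ} (h0 : 0 ≤ h) (k0 : 0 ≤ k) (D : ℕ) {K : ℕ} (hK : 0 < K)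
    {u : ℝ → ℝ → ℝ} {U : IPoly2} (hu : TMem2 S h k u U) (hB : tabs2 S h k U ≤ S) :
    TMem2 S h k (fun ρ σ => Real.sin (u ρ σ)) (tsinComp2 S h k D K U) := by
  intro ρ σ hρ hσ
  have hW : TMem2 S h k (fun ρ σ => u ρ σ * u ρ σ) (tmul2 S h k D U U) := tmem2_mul hS h0 k0 D hu hu
  have hP := tmem2_mul hS h0 k0 D hu (tmem2_horner hS h0 k0 D hW (sinHalfCoeffs K))
  obtain ⟨as, has, hev⟩ := hP ρ σ hρ hσ
  have hSr : (0 : ℝ) < S := by exact_mod_cast hS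
  have habs := abs_le_tabs2 h0 k0 hu hρ hσ
  have huB : |u ρ σ| ≤ ((tabs2 S h k U : ℤ) : ℝ) / S := by rw [le_div_iff₀ hSr]; exact habs
  have hu1 : |u ρ σ| ≤ 1 := by
    have : ((tabs2 S h k U : ℤ) : ℝ) ≤ S := by exact_mod_cast hB
    exact huB.trans ((div_le_one hSr).2 this)
  have hrem := (FB.cos_sin_taylor_remainder hu1 hK).2
  rw [← mul_eval_sinHalfCoeffs_sq_mv] at hrem
  have hδle := trig_rem_scaled_mv hS huB hrem
  obtain ⟨bs, hbs, hev2⟩ := exists_widen00 has hδle ρ σ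
  refine ⟨bs, hbs, ?_⟩
  rw [hev2, ← hev]
  ring

/-- The centred argument `u = g − c`, `c = mid00 S G`, as a bivariate Taylor model (first step of `TMComp`).
[cite: Joldes2011, Algorithm 2.2.8] -/
def tcentre2 (S : ℕ) (G : IPoly2) : IPoly2 := tsub2 G (tconst2 (ofRat S (mid00 S G)))

/-- `g − c ∈ tcentre2 S G`. [cite: Joldes2011, Algorithm 2.2.8] -/
theorem tmem2_centre {S : ℕ} {h k : ℚ} {g : ℝ → ℝ → ℝ} {G : IPoly2} (hg : TMem2 S h k g G) :
    TMem2 S h k (fun ρ σ => g ρ σ - ((mid00 S G : ℚ) : ℝ)) (tcentre2 S G) :=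
  tmem2_sub hg (tmem2_const (mem_ofRat S _))

/-- **The bivariate Taylor model of `sin ∘ g`** with its acceptance flag: `c = mid00 S G`, `u = g − c`,
`sin g = sin c · cos u + cos c · sin u`, `(cos c, sin c) ∈ cisPt S Kt kt (ofRat S c)`, `0 < K`, `|u|·S ≤ tabs2 ≤ S`.
[cite: Joldes2011, Algorithm 2.2.8] [cite: MakinoBerz2003, Definition 3] -/
def tsin2TM (S : ℕ) (h k : ℚ) (D K Kt kt : ℕ) (G : IPoly2) : IPoly2 × Bool :=
  let U := tcentre2 S G
  match cisPt S Kt kt (ofRat S (mid00 S G)) with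
  | none => ([], false)
  | some E => (tadd2 (tsmulI2 S E.im (tcosComp2 S h k D K U)) (tsmulI2 S E.re (tsinComp2 S h k D K U)),
      decide (0 < K) && decide (tabs2 S h k U ≤ S))

/-- **The bivariate Taylor model of `cos ∘ g`** with its acceptance flag: `c = mid00 S G`, `u = g − c`,
`cos g = cos c · cos u − sin c · sin u`. [cite: Joldes2011, Algorithm 2.2.8] [cite: MakinoBerz2003, Definition 3] -/
def tcos2TM (S : ℕ) (h k : ℚ) (D K Kt kt : ℕ) (G : IPoly2) : IPoly2 × Bool :=
  let U := tcentre2 S G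
  match cisPt S Kt kt (ofRat S (mid00 S G)) with
  | none => ([], false)
  | some E => (tsub2 (tsmulI2 S E.re (tcosComp2 S h k D K U)) (tsmulI2 S E.im (tsinComp2 S h k D K U)),
      decide (0 < K) && decide (tabs2 S h k U ≤ S))

/-- **Soundness of `tsin2TM`.** [cite: Joldes2011, Algorithm 2.2.8] [cite: MakinoBerz2003, Definition 3] -/
theorem tmem2_sin_of_tsin2TM {S : ℕ} (hS : 0 < S) {h k : ℚ} (h0 : 0 ≤ h) (k0 : 0 ≤ k) {D K Kt kt : ℕ}
    {g : ℝ → ℝ → ℝ} {G : IPoly2} (hg : TMem2 S h k g G) (hok : (tsin2TM S h k D K Kt kt G).2 = true) :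
    TMem2 S h k (fun ρ σ => Real.sin (g ρ σ)) (tsin2TM S h k D K Kt kt G).1 := by
  unfold tsin2TM at hok ⊢
  rcases hE : cisPt S Kt kt (ofRat S (mid00 S G)) with _ | E
  · simp only [hE] at hok; exact absurd hok Bool.false_ne_true
  · simp only [hE, Bool.and_eq_true, decide_eq_true_eq] at hok ⊢
    obtain ⟨hK, hB⟩ := hok
    have hc := mem_ofRat S (mid00 S G)
    have hcos := mem_cos_of_cisPt hS hE hc
    have hsin := mem_sin_of_cisPt hS hE hc
    have hU := tmem2_centre hg
    have hsum := tmem2_add (tmem2_smulI hS hsin (tmem2_cosComp hS h0 k0 D hK hU hB))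
      (tmem2_smulI hS hcos (tmem2_sinComp hS h0 k0 D hK hU hB))
    intro ρ σ hρ hσ
    obtain ⟨as, has, hev⟩ := hsum ρ σ hρ hσ
    refine ⟨as, has, ?_⟩
    rw [← hev]
    show Real.sin (g ρ σ) = Real.sin ((mid00 S G : ℚ) : ℝ) * Real.cos (g ρ σ - ((mid00 S G : ℚ) : ℝ)) +
      Real.cos ((mid00 S G : ℚ) : ℝ) * Real.sin (g ρ σ - ((mid00 S G : ℚ) : ℝ))
    rw [← Real.sin_add]
    congr 1
    ring

/-- **Soundness of `tcos2TM`.** [cite: Joldes2011, Algorithm 2.2.8] [cite: MakinoBerz2003, Definition 3] -/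
theorem tmem2_cos_of_tcos2TM {S : ℕ} (hS : 0 < S) {h k : ℚ} (h0 : 0 ≤ h) (k0 : 0 ≤ k) {D K Kt kt : ℕ}
    {g : ℝ → ℝ → ℝ} {G : IPoly2} (hg : TMem2 S h k g G) (hok : (tcos2TM S h k D K Kt kt G).2 = true) :
    TMem2 S h k (fun ρ σ => Real.cos (g ρ σ)) (tcos2TM S h k D K Kt kt G).1 := by
  unfold tcos2TM at hok ⊢
  rcases hE : cisPt S Kt kt (ofRat S (mid00 S G)) with _ | E
  · simp only [hE] at hok; exact absurd hok Bool.false_ne_true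
  · simp only [hE, Bool.and_eq_true, decide_eq_true_eq] at hok ⊢
    obtain ⟨hK, hB⟩ := hok
    have hc := mem_ofRat S (mid00 S G)
    have hcos := mem_cos_of_cisPt hS hE hc
    have hsin := mem_sin_of_cisPt hS hE hc
    have hU := tmem2_centre hg
    have hdiff := tmem2_sub (tmem2_smulI hS hcos (tmem2_cosComp hS h0 k0 D hK hU hB))
      (tmem2_smulI hS hsin (tmem2_sinComp hS h0 k0 D hK hU hB))
    intro ρ σ hρ hσ
    obtain ⟨as, has, hev⟩ := hdiff ρ σ hρ hσ
    refine ⟨as, has, ?_⟩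
    rw [← hev]
    show Real.cos (g ρ σ) = Real.cos ((mid00 S G : ℚ) : ℝ) * Real.cos (g ρ σ - ((mid00 S G : ℚ) : ℝ)) -
      Real.sin ((mid00 S G : ℚ) : ℝ) * Real.sin (g ρ σ - ((mid00 S G : ℚ) : ℝ))
    rw [← Real.cos_add]
    congr 1
    ring

/-! ### Three variables: `cos ∘ u`, `sin ∘ u` for a small `u`, then `sin ∘ g`, `cos ∘ g` -/

/-- The trivariate Taylor model of `(ρ, σ, τ) ↦ cos (u ρ σ τ)` for a small `u`. [cite: Joldes2011, Section 2.2.1]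
[cite: MakinoBerz2003, Definition 3] -/
def tcosComp3 (S : ℕ) (h k l : ℚ) (D K : ℕ) (U : IPoly3) : IPoly3 :=
  widen000 (thorner3 S h k l D (cosHalfCoeffs K) (tmul3 S h k l D U U)) (ttrigCompRem S (tabs3 S h k l U) K)

/-- The trivariate Taylor model of `(ρ, σ, τ) ↦ sin (u ρ σ τ)` for a small `u`. [cite: Joldes2011, Section 2.2.1]
[cite: MakinoBerz2003, Definition 3] -/
def tsinComp3 (S : ℕ) (h k l : ℚ) (D K : ℕ) (U : IPoly3) : IPoly3 :=
  widen000 (tmul3 S h k l D U (thorner3 S h k l D (sinHalfCoeffs K) (tmul3 S h k l D U U)))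
    (ttrigCompRem S (tabs3 S h k l U) K)

/-- **Soundness of `tcosComp3`** (`0 < K`, `tabs3 S h k l U ≤ S`). [cite: Joldes2011, Section 2.2.1]
[cite: MakinoBerz2003, Definition 3] -/
theorem tmem3_cosComp {S : ℕ} (hS : 0 < S) {h k l : ℚ} (h0 : 0 ≤ h) (k0 : 0 ≤ k) (l0 : 0 ≤ l) (D : ℕ) {K : ℕ}
    (hK : 0 < K) {u : ℝ → ℝ → ℝ → ℝ} {U : IPoly3} (hu : TMem3 S h k l u U) (hB : tabs3 S h k l U ≤ S) :
    TMem3 S h k l (fun ρ σ τ => Real.cos (u ρ σ τ)) (tcosComp3 S h k l D K U) := by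
  intro ρ σ τ hρ hσ hτ
  have hW : TMem3 S h k l (fun ρ σ τ => u ρ σ τ * u ρ σ τ) (tmul3 S h k l D U U) := tmem3_mul hS h0 k0 l0 D hu hu
  obtain ⟨as, has, hev⟩ := tmem3_horner hS h0 k0 l0 D hW (cosHalfCoeffs K) ρ σ τ hρ hσ hτ
  have hSr : (0 : ℝ) < S := by exact_mod_cast hS
  have habs := abs_le_tabs3 h0 k0 l0 hu hρ hσ hτ
  have huB : |u ρ σ τ| ≤ ((tabs3 S h k l U : ℤ) : ℝ) / S := by rw [le_div_iff₀ hSr]; exact habs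
  have hu1 : |u ρ σ τ| ≤ 1 := by
    have : ((tabs3 S h k l U : ℤ) : ℝ) ≤ S := by exact_mod_cast hB
    exact huB.trans ((div_le_one hSr).2 this)
  have hrem := (FB.cos_sin_taylor_remainder hu1 hK).1
  rw [← eval_cosHalfCoeffs_sq_mv] at hrem
  have hδle := trig_rem_scaled_mv hS huB hrem
  obtain ⟨bs, hbs, hev2⟩ := exists_widen000 has hδle ρ σ τ
  refine ⟨bs, hbs, ?_⟩
  rw [hev2, ← hev]
  ring

/-- **Soundness of `tsinComp3`** (`0 < K`, `tabs3 S h k l U ≤ S`). [cite: Joldes2011, Section 2.2.1]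
[cite: MakinoBerz2003, Definition 3] -/
theorem tmem3_sinComp {S : ℕ} (hS : 0 < S) {h k l : ℚ} (h0 : 0 ≤ h) (k0 : 0 ≤ k) (l0 : 0 ≤ l) (D : ℕ) {K : ℕ}
    (hK : 0 < K) {u : ℝ → ℝ → ℝ → ℝ} {U : IPoly3} (hu : TMem3 S h k l u U) (hB : tabs3 S h k l U ≤ S) :
    TMem3 S h k l (fun ρ σ τ => Real.sin (u ρ σ τ)) (tsinComp3 S h k l D K U) := by
  intro ρ σ τ hρ hσ hτ
  have hW : TMem3 S h k l (fun ρ σ τ => u ρ σ τ * u ρ σ τ) (tmul3 S h k l D U U) := tmem3_mul hS h0 k0 l0 D hu hu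
  have hP := tmem3_mul hS h0 k0 l0 D hu (tmem3_horner hS h0 k0 l0 D hW (sinHalfCoeffs K))
  obtain ⟨as, has, hev⟩ := hP ρ σ τ hρ hσ hτ
  have hSr : (0 : ℝ) < S := by exact_mod_cast hS
  have habs := abs_le_tabs3 h0 k0 l0 hu hρ hσ hτ
  have huB : |u ρ σ τ| ≤ ((tabs3 S h k l U : ℤ) : ℝ) / S := by rw [le_div_iff₀ hSr]; exact habs
  have hu1 : |u ρ σ τ| ≤ 1 := by
    have : ((tabs3 S h k l U : ℤ) : ℝ) ≤ S := by exact_mod_cast hB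
    exact huB.trans ((div_le_one hSr).2 this)
  have hrem := (FB.cos_sin_taylor_remainder hu1 hK).2
  rw [← mul_eval_sinHalfCoeffs_sq_mv] at hrem
  have hδle := trig_rem_scaled_mv hS huB hrem
  obtain ⟨bs, hbs, hev2⟩ := exists_widen000 has hδle ρ σ τ
  refine ⟨bs, hbs, ?_⟩
  rw [hev2, ← hev]
  ring

/-- The centred argument `u = g − c`, `c = mid000 S G`, as a trivariate Taylor model. [cite: Joldes2011, Algorithm 2.2.8] -/
def tcentre3 (S : ℕ) (G : IPoly3) : IPoly3 := tsub3 G (tconst3 (ofRat S (mid000 S G)))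

/-- `g − c ∈ tcentre3 S G`. [cite: Joldes2011, Algorithm 2.2.8] -/
theorem tmem3_centre {S : ℕ} {h k l : ℚ} {g : ℝ → ℝ → ℝ → ℝ} {G : IPoly3} (hg : TMem3 S h k l g G) :
    TMem3 S h k l (fun ρ σ τ => g ρ σ τ - ((mid000 S G : ℚ) : ℝ)) (tcentre3 S G) :=
  tmem3_sub hg (tmem3_const (mem_ofRat S _))

/-- **The trivariate Taylor model of `sin ∘ g`** with its acceptance flag (`c = mid000 S G`, `u = g − c`,
`sin g = sin c · cos u + cos c · sin u`). [cite: Joldes2011, Algorithm 2.2.8] [cite: MakinoBerz2003, Definition 3] -/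
def tsin3TM (S : ℕ) (h k l : ℚ) (D K Kt kt : ℕ) (G : IPoly3) : IPoly3 × Bool :=
  let U := tcentre3 S G
  match cisPt S Kt kt (ofRat S (mid000 S G)) with
  | none => ([], false)
  | some E => (tadd3 (tsmulI3 S E.im (tcosComp3 S h k l D K U)) (tsmulI3 S E.re (tsinComp3 S h k l D K U)),
      decide (0 < K) && decide (tabs3 S h k l U ≤ S))

/-- **The trivariate Taylor model of `cos ∘ g`** with its acceptance flag (`cos g = cos c · cos u − sin c · sin u`).
[cite: Joldes2011, Algorithm 2.2.8] [cite: MakinoBerz2003, Definition 3] -/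
def tcos3TM (S : ℕ) (h k l : ℚ) (D K Kt kt : ℕ) (G : IPoly3) : IPoly3 × Bool :=
  let U := tcentre3 S G
  match cisPt S Kt kt (ofRat S (mid000 S G)) with
  | none => ([], false)
  | some E => (tsub3 (tsmulI3 S E.re (tcosComp3 S h k l D K U)) (tsmulI3 S E.im (tsinComp3 S h k l D K U)),
      decide (0 < K) && decide (tabs3 S h k l U ≤ S))

/-- **Soundness of `tsin3TM`.** [cite: Joldes2011, Algorithm 2.2.8] [cite: MakinoBerz2003, Definition 3] -/
theorem tmem3_sin_of_tsin3TM {S : ℕ} (hS : 0 < S) {h k l : ℚ} (h0 : 0 ≤ h) (k0 : 0 ≤ k) (l0 : 0 ≤ l)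
    {D K Kt kt : ℕ} {g : ℝ → ℝ → ℝ → ℝ} {G : IPoly3} (hg : TMem3 S h k l g G)
    (hok : (tsin3TM S h k l D K Kt kt G).2 = true) :
    TMem3 S h k l (fun ρ σ τ => Real.sin (g ρ σ τ)) (tsin3TM S h k l D K Kt kt G).1 := by
  unfold tsin3TM at hok ⊢
  rcases hE : cisPt S Kt kt (ofRat S (mid000 S G)) with _ | E
  · simp only [hE] at hok; exact absurd hok Bool.false_ne_true
  · simp only [hE, Bool.and_eq_true, decide_eq_true_eq] at hok ⊢
    obtain ⟨hK, hB⟩ := hok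
    have hc := mem_ofRat S (mid000 S G)
    have hcos := mem_cos_of_cisPt hS hE hc
    have hsin := mem_sin_of_cisPt hS hE hc
    have hU := tmem3_centre hg
    have hsum := tmem3_add (tmem3_smulI hS hsin (tmem3_cosComp hS h0 k0 l0 D hK hU hB))
      (tmem3_smulI hS hcos (tmem3_sinComp hS h0 k0 l0 D hK hU hB))
    intro ρ σ τ hρ hσ hτ
    obtain ⟨as, has, hev⟩ := hsum ρ σ τ hρ hσ hτ
    refine ⟨as, has, ?_⟩
    rw [← hev]
    show Real.sin (g ρ σ τ) =
      Real.sin ((mid000 S G : ℚ) : ℝ) * Real.cos (g ρ σ τ - ((mid000 S G : ℚ) : ℝ)) +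
        Real.cos ((mid000 S G : ℚ) : ℝ) * Real.sin (g ρ σ τ - ((mid000 S G : ℚ) : ℝ))
    rw [← Real.sin_add]
    congr 1
    ring

/-- **Soundness of `tcos3TM`.** [cite: Joldes2011, Algorithm 2.2.8] [cite: MakinoBerz2003, Definition 3] -/
theorem tmem3_cos_of_tcos3TM {S : ℕ} (hS : 0 < S) {h k l : ℚ} (h0 : 0 ≤ h) (k0 : 0 ≤ k) (l0 : 0 ≤ l)
    {D K Kt kt : ℕ} {g : ℝ → ℝ → ℝ → ℝ} {G : IPoly3} (hg : TMem3 S h k l g G)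
    (hok : (tcos3TM S h k l D K Kt kt G).2 = true) :
    TMem3 S h k l (fun ρ σ τ => Real.cos (g ρ σ τ)) (tcos3TM S h k l D K Kt kt G).1 := by
  unfold tcos3TM at hok ⊢
  rcases hE : cisPt S Kt kt (ofRat S (mid000 S G)) with _ | E
  · simp only [hE] at hok; exact absurd hok Bool.false_ne_true
  · simp only [hE, Bool.and_eq_true, decide_eq_true_eq] at hok ⊢
    obtain ⟨hK, hB⟩ := hok
    have hc := mem_ofRat S (mid000 S G)
    have hcos := mem_cos_of_cisPt hS hE hc
    have hsin := mem_sin_of_cisPt hS hE hc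
    have hU := tmem3_centre hg
    have hdiff := tmem3_sub (tmem3_smulI hS hcos (tmem3_cosComp hS h0 k0 l0 D hK hU hB))
      (tmem3_smulI hS hsin (tmem3_sinComp hS h0 k0 l0 D hK hU hB))
    intro ρ σ τ hρ hσ hτ
    obtain ⟨as, has, hev⟩ := hdiff ρ σ τ hρ hσ hτ
    refine ⟨as, has, ?_⟩
    rw [← hev]
    show Real.cos (g ρ σ τ) =
      Real.cos ((mid000 S G : ℚ) : ℝ) * Real.cos (g ρ σ τ - ((mid000 S G : ℚ) : ℝ)) -
        Real.sin ((mid000 S G : ℚ) : ℝ) * Real.sin (g ρ σ τ - ((mid000 S G : ℚ) : ℝ))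
    rw [← Real.cos_add]
    congr 1
    ring

end PolyMP

end Literature.Analysis.ValidatedNumerics
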